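import Summits.QuantumFields.BalabanUV.Beta.GAN24.CombTransportedBorder
import Summits.QuantumFields.BalabanUV.Beta.GAN24.SlotTransportPeriodicWeight
import Summits.QuantumFields.BalabanUV.Beta.GAN24.SymCorrectorZeroSymbol

/-!
# `BalabanUV.Beta.GAN24.CombSlotResumTransport` — binder row G-an2-4 ∕ (CONV-C), TRANSFER-III, the (III′) (C)-campaign's supplier `hB0`, toward (24) AT THE COMB DATA:
# **THE HALF-VERTEX OF A TRANSPORTED TABLE IS THE LEG-CONJUGATE OF THE HALF-VERTEX OF THE SLOT-TRANSPORTED TABLE** — `vertexOfK K n (𝒯 S) b = Ψ̂ᵀ ∘ vertexOfK K n (slotPsiS S) b ∘ Ψ̂`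
# (road-P2 M.43 §2 read backwards), with units (`CombTransportedBorder.transport_unitS ∕ slotPsiS_unitS`), and **THE PERIODICALLY WEIGHTED RESUMMED SLOT OF `slotPsiS S` IS THAT OF `S`**
# (`SlotTransportPeriodicWeight`): the two identities through which (24)_comb reduces to (E)'s fact (d1) (README-g85 «LOCATED»)
# (G-an2-4 CRUX TEAM (2), leaf prover `b2b-balaban-gan24-formalise-leaf-01`, gen 85; journal [LEAF01-G85-INTENT-8])

NOT IN PRINT; OUR BOOKKEEPING ([folklore] BY NAME; 0 `def`, 0 cited fact, 0 `def … : Prop`, 0 sorry).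
HONEST FRAMING (cell contract, verbatim): «discharging `BetaPertH` makes Bałaban's UV stability UNCONDITIONAL — a real constructive-QFT result; it is NOT the continuum limit and NOT
the Clay problem.»  HONEST DEPENDENCY (verbatim): «continuum YM on T⁴ ⇐ BetaPertH ∧ nine spine estimates (0/9 proved); BetaPertH ⇐ (D1) ∧ (D4) ∧ CAP+tail; G-an2-4 gates asym, D1
and NE2/3/4.»

## What is proved (generic `d`, `0 < n`, `r ∈ box (d+1) n`, `Ψ̂ = psiKS r n`)
* §1 **`vertexOfK_transport_eq_conj`**: for a decaying `K` and a local stencil family `S`, `vertexOfK K n (κ u ↦ Ψ̂ᵀ∘slotPsiS r n S κ u∘Ψ̂) b = Ψ̂ᵀ ∘ vertexOfK K n (slotPsiS r n S) b ∘ Ψ̂`;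
  **`vertexOfK_unitS_transport_eq_conj`** (the same with units: `vertexOfK K n (unitS s_f s_m (𝒯 S)) b = Ψ̂ᵀ ∘ vertexOfK K n (unitS s_f s_m (slotPsiS r n S)) b ∘ Ψ̂`).
* §2 **PERIODICALLY WEIGHTED LEG SUMS ARE BLIND TO THE SLOT LEGS OF THE TRANSPORT** (leaf-01 g85 F7 `SlotTransportPeriodicWeight.tsum_weight_mul_slotPsiS` through the apply bridges of
  `SymCorrectorSlot`): for an `n`-periodic bounded weight `ω` and summable rows ∕ columns, `Σ'_w ω w·(X ∘ Ψ̂)(x,w)_{ab} = Σ'_w ω w·X(x,w)_{ab}` (`tsum_weight_mul_comp_psiKS_right`) and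
  `Σ'_x ω x·(Ψ̂ᵀ ∘ X)(x,w)_{ab} = Σ'_x ω x·X(x,w)_{ab}` (`tsum_weight_mul_comp_trK_psiKS_left`).
* §3 **… AND TO ITS CORRECTOR LEGS**: `tsum_periodic_mul_comp_blk` (a periodically weighted sum of a block function factorises), **`tsum_weight_mul_corrPsiS`**
  (`Σ'_x ω x·(Ψ_S F)_α(x) = Σ'_x ω x·F_α(x)`: the gradient of the block-constant defect potential lives on the exit faces, where the periodic weight has the same face sum in every
  block, and the block differences of the summable potential `ζ_S F` telescope to zero — g84 F5 `summable_zetaS`), hence `Σ'_x ω x·(Ψ̂ ∘ X)(x,z)_{ab} = Σ'_x ω x·X(x,z)_{ab}`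
  (`tsum_weight_mul_psiKS_comp_left`) and `Σ'_z ω z·(X ∘ Ψ̂ᵀ)(x,z)_{ab} = Σ'_z ω z·X(x,z)_{ab}` (`tsum_weight_mul_comp_trK_psiKS_right`).
* §3b **`tsum_sum_conj_psiKS_inr_inl_mul_periodic`**: the `hkill`-transfer — the multiplier rows of `Ψ̂ X Ψ̂ᵀ` pair with a periodic bounded current exactly as those of `X`.
* §3c **`tsum_prod_weight_conj_psiKS`**: BOTH outer legs at once — `Σ'_{(y,w)} ω₁ y·ω₂ w·(Ψ̂ᵀ∘Z∘Ψ̂)(y,w)_{ab} = Σ'_{(y,w)} ω₁ y·ω₂ w·Z(y,w)_{ab}` for a bi-localised `Z`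
  (`exists_biLoc_conj_psiKS`: conjugates of bi-localised kernels are bi-localised).
* §4 **`tsum_vertexOfK_dressedStep_slotPsiS`**: the bond sum of the DRESSED chain-rule vertex (`X̃♮_j = unitK s_f s_m (coDressKBmAt (toSite rb) Lc (KInvStep Lc j))`, every `j`) of a
  slot-transported local table is that of the table (leaf-04 `DressedHalfVertex.hasSum_vertexOfK_dressedStep` + F7): the resummed slot of (24)_comb loses its slot transport.
ROUTE OF (24)_comb THROUGH THESE IDENTITIES (README-g85 «LOCATED» (a); the Fubini run itself is NOT in this file): the direct word is
`Σ_{u′} 𝟙_αᵀ (Ψ̂ᵀ P′ Ψ̂) X̃ (Ψ̂ᵀ V′_{u′} Ψ̂) 𝟙_β` with `P′ = vertexOfK X̃ Lc (unitS (slotPsiS VH′)) μ c`, `V′_{u′} = vertexOfK X̃ Lc (unitS (slotPsiS E′)) ν u′` (§1); the OUTER `Ψ̂ᵀ` ∕ `Ψ̂` drop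
against the exit-face weights `𝟙_α(y)`, `𝟙_β(w)` (§2, both at once §3c); the INNER pair dresses the middle kernel to `Ψ̂ X̃ Ψ̂ᵀ`, on whose multiplier rows `Ψ̂` is the identity
(`SymCorrectorKernel.comp_psiKS_inr`) and whose right `Ψ̂ᵀ` drops against the `Lc`-periodic exit-face current of (d1) (§3, packaged as the `hkill`-transfer §3b); the resummed
slot `Σ_{u′} V′_{u′}` loses `slotPsiS` (§4) — after which leaf-04's `VHWordsZeroLattice.tsum_noFF_left_wilson_right_word_eq_zero_of` pattern closes on (d1) verbatim.
WHAT THIS IS NOT: the (24)_comb word itself (leaf-04's `VHWordsZeroLattice` route run on the transported sector table) is NOT assembled here; NO value; NOT `hB0`; NEVER «G-an2-4 closed» as (CONV-C); NOT D1, NOT `BetaPertH`, NOT continuum, NOT Clay.  2026-08-27; no existing file touched.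
-/

noncomputable section

open Finset
open scoped BigOperators
open Literature.MathematicalPhysics.QuantumFieldTheory
open Literature.MathematicalPhysics.QuantumFieldTheory.Balaban1983to89
open Literature.MathematicalPhysics.QuantumFieldTheory.Balaban1983to89.Beta
open ExpKernelCalculus (Site MKer comp Decays BiLoc biLoc_comp_decays)
open BalabanStepJetsSucc (biLoc_comp_right decays_comp)
open AxialDressing (summable_col_of_biLoc summable_row_of_biLoc summable_row_of_decays)
open AffineAveraging (Form1 box toSite unitVec)
open AveragingContours (blk blk_block)
open AxialProjector (blk_add_zsmul)
open OneStepResolventKernel (Fib LocStencil)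
open OneStepKernelFamily (KInvStep vertexOfK)
open Summit.QuantumFields.BalabanUV.Beta.TameKernelCalculus (trK trK_apply Spr decays_of_le decays_trK)
open BalabanCompositeJets (summable_slice_of_locStencil)
open Summit.QuantumFields.BalabanUV.Beta.AxialDressingRooted (coDressKBmAt)
open Summit.QuantumFields.BalabanUV.Beta.HessKerDressedUnits (unitK unitS locStencil_unitS)
open Summit.QuantumFields.BalabanUV.Beta.SymCorrectorForms (zetaS corrPsiS corrPsiS_apply corrPsiS_apply_of_blk_eq)
open Summit.QuantumFields.BalabanUV.Beta.SymCorrectorKernel (psiKS spr_psiKS decays_psiKS comp_psiKS_inl comp_psiKS_inr comp_trK_psiKS_inl comp_trK_psiKS_inr)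
open Summit.QuantumFields.BalabanUV.Beta.SymCorrectorFace (slotPsiS)
open Summit.QuantumFields.BalabanUV.Beta.SymCorrectorSlot (comp_trK_psiKS_inl_left comp_trK_psiKS_inr_left comp_psiKS_inl_right comp_psiKS_inr_right)
open Summit.QuantumFields.BalabanUV.Beta.CompositeCorrectorKernel (blk_add_unitVec)
open Summit.QuantumFields.BalabanUV.Beta.GAN24.SymCorrectorZeroMode (summable_comp_blk)
open Summit.QuantumFields.BalabanUV.Beta.GAN24.KernelLegCharges (summable_prod_of_biLoc)
open Summit.QuantumFields.BalabanUV.Beta.GAN24.SymCorrectorZeroSymbol (summable_zetaS)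
open Summit.QuantumFields.BalabanUV.Beta.GAN24.SlotTransportPeriodicWeight (summable_weight_mul tsum_weight_mul_slotPsiS tsum_weight_mul_slotPsiS_kernel)
open Summit.QuantumFields.BalabanUV.Beta.GAN24.DressedHalfVertex (hasSum_vertexOfK_dressedStep)
open Summit.QuantumFields.BalabanUV.Beta.SymCorrectorSockets (locStencil_slotPsiS)
open Summit.QuantumFields.BalabanUV.Beta.GAN24.CombCubicStepTransport (conj_vertexOfK_eq_vertexOfK_conj)
open Summit.QuantumFields.BalabanUV.Beta.GAN24.CombTransportedBorder (transport_unitS slotPsiS_unitS)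

namespace Summit.QuantumFields.BalabanUV.Beta.GAN24.CombSlotResumTransport

variable {d : ℕ}

section Transport

variable {n : ℕ} (hn : 0 < n) {r : Fin (d + 1) → ℕ} (hr : r ∈ box (d + 1) n)
include hn hr

/-! ## §1 The half-vertex of a transported table -/

/-- NOT IN PRINT; OUR BOOKKEEPING ([folklore]; road-P2 M.43 §2 read backwards).  **`vertexOfK K n (𝒯 S) b = Ψ̂ᵀ ∘ vertexOfK K n (slotPsiS r n S) b ∘ Ψ̂`** for a kernel `K` decaying at a
positive rate and a local stencil family `S` (`0 < δ`): the leg congruence of the transport passes OUT of the chain-rule vertex (its column weights are scalars). -/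
theorem vertexOfK_transport_eq_conj {K : MKer (d + 1) (Fib d)} (hK : Spr K) {S : Fin (d + 1) → Site (d + 1) → MKer (d + 1) (Fib d)} {Cs δs : ℝ}
    (hS : LocStencil S Cs δs) (hδs : 0 < δs) (ν : Fin (d + 1)) (u' : Site (d + 1)) :
    vertexOfK K n (fun κ u => comp (comp (trK (psiKS r n)) (slotPsiS r n S κ u)) (psiKS r n)) ν u'
      = comp (comp (trK (psiKS r n)) (vertexOfK K n (slotPsiS r n S) ν u')) (psiKS r n) := by
  obtain ⟨C, δ, hδ, hKd⟩ := hK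
  exact (conj_vertexOfK_eq_vertexOfK_conj (N := n) (spr_psiKS hn hr) ⟨δ, |C|, hδ, abs_nonneg C, decays_of_le hKd le_rfl⟩ (locStencil_slotPsiS (d := d) hn r hS hδs.le) hδs ν u').symm

/-- NOT IN PRINT; OUR BOOKKEEPING ([folklore]).  **THE SAME WITH UNITS**: `vertexOfK K n (unitS s_f s_m (𝒯 S)) b = Ψ̂ᵀ ∘ vertexOfK K n (unitS s_f s_m (slotPsiS r n S)) b ∘ Ψ̂`
(leaf-01 g85's `transport_unitS ∕ slotPsiS_unitS`: the units commute with both parts of the transport). -/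
theorem vertexOfK_unitS_transport_eq_conj {K : MKer (d + 1) (Fib d)} (hK : Spr K) (sf sm : ℝ) {S : Fin (d + 1) → Site (d + 1) → MKer (d + 1) (Fib d)} {Cs δs : ℝ}
    (hS : LocStencil S Cs δs) (hδs : 0 < δs) (ν : Fin (d + 1)) (u' : Site (d + 1)) :
    vertexOfK K n (unitS sf sm (fun κ u => comp (comp (trK (psiKS r n)) (slotPsiS r n S κ u)) (psiKS r n))) ν u'
      = comp (comp (trK (psiKS r n)) (vertexOfK K n (unitS sf sm (slotPsiS r n S)) ν u')) (psiKS r n) := by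
  rw [← transport_unitS r n sf sm S, vertexOfK_transport_eq_conj hn hr hK (locStencil_unitS (sf := sf) (sm := sm) hS) hδs ν u', slotPsiS_unitS]

/-! ## §2 Periodically weighted leg sums do not see the slot legs of the transport -/

/-- NOT IN PRINT; OUR BOOKKEEPING ([folklore]).  **RIGHT CORRECTOR, RIGHT LEG WEIGHTED**: for `X` with summable rows at `(x, a)` and an `n`-periodic weight `ω` bounded by `B`,
`Σ'_w ω w · (X ∘ Ψ̂_S)(x, w)_{ab} = Σ'_w ω w · X(x, w)_{ab}` — on a field leg `b = inl β` the right corrector is the slot transport of the row (`SymCorrectorSlot.comp_psiKS_inl_right`) and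
leaf-01 g85 F7 applies; a multiplier leg is untouched. -/
theorem tsum_weight_mul_comp_psiKS_right (X : MKer (d + 1) (Fib d)) (x : Site (d + 1)) (a b : Fib d) (hX : ∀ b' : Fib d, Summable fun w => X x w a b')
    {ω : Site (d + 1) → ℝ} {B : ℝ} (hω : ∀ w, |ω w| ≤ B) (hωper : ∀ w t : Site (d + 1), ω (w + (n : ℤ) • t) = ω w) :
    ∑' w, ω w * comp X (psiKS r n) x w a b = ∑' w, ω w * X x w a b := by
  rcases b with β | m
  · rw [tsum_congr fun w => by rw [comp_psiKS_inl_right hn hr X x w a β]]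
    exact tsum_weight_mul_slotPsiS hn r (T := fun κ u => X x u a (Sum.inl κ)) (fun κ => hX (Sum.inl κ)) hω hωper β
  · exact tsum_congr fun w => by rw [comp_psiKS_inr_right X x w a m]

/-- NOT IN PRINT; OUR BOOKKEEPING ([folklore]).  **LEFT TRANSPOSED CORRECTOR, LEFT LEG WEIGHTED**: for `X` with summable columns at `(w, b)`,
`Σ'_x ω x · (Ψ̂_Sᵀ ∘ X)(x, w)_{ab} = Σ'_x ω x · X(x, w)_{ab}` (`SymCorrectorSlot.comp_trK_psiKS_inl_left` + F7). -/
theorem tsum_weight_mul_comp_trK_psiKS_left (X : MKer (d + 1) (Fib d)) (w : Site (d + 1)) (a b : Fib d) (hX : ∀ a' : Fib d, Summable fun x => X x w a' b)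
    {ω : Site (d + 1) → ℝ} {B : ℝ} (hω : ∀ x, |ω x| ≤ B) (hωper : ∀ x t : Site (d + 1), ω (x + (n : ℤ) • t) = ω x) :
    ∑' x, ω x * comp (trK (psiKS r n)) X x w a b = ∑' x, ω x * X x w a b := by
  rcases a with β | m
  · rw [tsum_congr fun x => by rw [comp_trK_psiKS_inl_left hn hr X x w β b]]
    exact tsum_weight_mul_slotPsiS hn r (T := fun κ u => X u w (Sum.inl κ) b) (fun κ => hX (Sum.inl κ)) hω hωper β
  · exact tsum_congr fun x => by rw [comp_trK_psiKS_inr_left X x w m b]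

/-! ## §3 … nor its corrector legs -/

omit hr in
/-- [folklore] **A PERIODICALLY WEIGHTED SUM OF A BLOCK FUNCTION FACTORISES**: for an `n`-periodic weight `w`, `Σ'_x w x · g (blk x) = (Σ_{b ∈ box} w b) · Σ'_Y g Y` whenever the left
series converges (cell decomposition `BiStencilZeroMode.tsum_eq_sum_box_tsum`). -/
theorem tsum_periodic_mul_comp_blk {w g : Site (d + 1) → ℝ} (hwper : ∀ x t : Site (d + 1), w (x + (n : ℤ) • t) = w x)
    (hs : Summable fun x : Site (d + 1) => w x * g (blk n x)) :
    ∑' x, w x * g (blk n x) = (∑ b ∈ box (d + 1) n, w (toSite b)) * ∑' Y, g Y := by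
  haveI : NeZero n := ⟨hn.ne'⟩
  rw [BiStencilZeroMode.tsum_eq_sum_box_tsum (N := n) hs, Finset.sum_mul]
  refine Finset.sum_congr rfl fun b hb => ?_
  have hwb : ∀ t : Site (d + 1), w ((n : ℤ) • t + toSite b) = w (toSite b) := fun t => by rw [add_comm, hwper]
  simp only [blk_block _ hb, hwb]
  rw [← tsum_mul_left]

/-- NOT IN PRINT; OUR BOOKKEEPING ([folklore]).  **A PERIODICALLY WEIGHTED BOND SUM IS BLIND TO THE CORRECTOR `Ψ_S`**: for a field `F` with summable components, an in-block root and an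
`n`-periodic weight `ω` bounded by `B`, `Σ'_x ω x · (Ψ_S F)_α(x) = Σ'_x ω x · F_α(x)`.  The correction `|box|⁻¹·(ζ_S F (blk (x+e_α)) − ζ_S F (blk x))` lives on the exit face of
direction `α` (`CompositeCorrectorKernelSpr.blk_add_unitVec`), the exit-face indicator is `n`-periodic, so by `tsum_periodic_mul_comp_blk` the weighted correction is a cell constant
times `Σ'_Y (ζ_S F (Y + e_α) − ζ_S F Y) = 0` (`ζ_S F` is summable, g84 F5 `summable_zetaS`). -/
theorem tsum_weight_mul_corrPsiS {F : Form1 (d + 1) ℝ} (hF : ∀ κ, Summable (F κ)) {ω : Site (d + 1) → ℝ} {B : ℝ} (hω : ∀ x, |ω x| ≤ B)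
    (hωper : ∀ x t : Site (d + 1), ω (x + (n : ℤ) • t) = ω x) (α : Fin (d + 1)) :
    ∑' x, ω x * corrPsiS (toSite r) n F α x = ∑' x, ω x * F α x := by
  classical
  haveI : NeZero n := ⟨hn.ne'⟩
  set c : ℝ := ((box (d + 1) n).card : ℝ)⁻¹ with hc
  set ζ : Site (d + 1) → ℝ := zetaS (toSite r) n F with hζdef
  set g : Site (d + 1) → ℝ := fun Y => ζ (Y + unitVec α) - ζ Y with hg
  set χ : Site (d + 1) → ℝ := fun x => if blk n (x + unitVec α) = blk n x then 0 else 1 with hχ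
  have e : ∀ x, ω x * corrPsiS (toSite r) n F α x = ω x * F α x + c * ((ω x * χ x) * g (blk n x)) := by
    intro x
    by_cases hx : blk n (x + unitVec α) = blk n x
    · rw [corrPsiS_apply_of_blk_eq _ _ _ hx]
      simp only [hχ, hx, if_true, mul_zero, zero_mul, add_zero]
    · have hx' : blk n (x + unitVec α) = blk n x + unitVec α := (blk_add_unitVec hn x α).resolve_left hx
      have hχx : χ x = 1 := by simp only [hχ, hx, if_false]
      rw [corrPsiS_apply, hx', hχx]
      simp only [hg, hζdef, hc]
      ring
  have hχper : ∀ x t : Site (d + 1), χ (x + (n : ℤ) • t) = χ x := by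
    intro x t
    simp only [hχ]
    rw [show x + (n : ℤ) • t + unitVec α = (x + unitVec α) + (n : ℤ) • t by abel, blk_add_zsmul hn, blk_add_zsmul hn]
    simp only [add_left_inj]
  have hωχ : ∀ x, |ω x * χ x| ≤ B := fun x => by
    have hB : 0 ≤ B := (abs_nonneg _).trans (hω x)
    rw [abs_mul]
    by_cases hx : blk n (x + unitVec α) = blk n x
    · simp only [hχ, hx, if_true, abs_zero, mul_zero]; exact hB
    · simp only [hχ, hx, if_false, abs_one, mul_one]; exact hω x
  have hζ : Summable ζ := summable_zetaS hn hr hF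
  have hζe : Summable fun Y => ζ (Y + unitVec α) := hζ.comp_injective (add_left_injective (unitVec α))
  have hgs : Summable g := hζe.sub hζ
  have hs2 : Summable fun x => (ω x * χ x) * g (blk n x) := summable_weight_mul hωχ (summable_comp_blk hn hgs)
  have hgsum : ∑' Y, g Y = 0 := by
    rw [hg, hζe.tsum_sub hζ, show (∑' Y, ζ (Y + unitVec α)) = ∑' Y, ζ Y from (Equiv.addRight (unitVec α)).tsum_eq ζ, sub_self]
  rw [tsum_congr e, (summable_weight_mul hω (hF α)).tsum_add (hs2.mul_left c), tsum_mul_left,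
    tsum_periodic_mul_comp_blk hn (w := fun x => ω x * χ x) (fun x t => by simp only [hωper, hχper]) hs2, hgsum, mul_zero, mul_zero, add_zero]

/-- NOT IN PRINT; OUR BOOKKEEPING ([folklore]).  **LEFT CORRECTOR, LEFT LEG WEIGHTED**: for `X` with summable columns at `(z, b)`,
`Σ'_x ω x · (Ψ̂_S ∘ X)(x, z)_{ab} = Σ'_x ω x · X(x, z)_{ab}` (apply bridge `SymCorrectorKernel.comp_psiKS_inl` + `tsum_weight_mul_corrPsiS`). -/
theorem tsum_weight_mul_psiKS_comp_left (X : MKer (d + 1) (Fib d)) (z : Site (d + 1)) (a b : Fib d) (hX : ∀ a' : Fib d, Summable fun x => X x z a' b)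
    {ω : Site (d + 1) → ℝ} {B : ℝ} (hω : ∀ x, |ω x| ≤ B) (hωper : ∀ x t : Site (d + 1), ω (x + (n : ℤ) • t) = ω x) :
    ∑' x, ω x * comp (psiKS r n) X x z a b = ∑' x, ω x * X x z a b := by
  rcases a with α | m
  · rw [tsum_congr fun x => by rw [comp_psiKS_inl hn hr X x z α b]]
    exact tsum_weight_mul_corrPsiS hn hr (F := fun κ y => X y z (Sum.inl κ) b) (fun κ => hX (Sum.inl κ)) hω hωper α
  · exact tsum_congr fun x => by rw [comp_psiKS_inr X x z m b]

/-- NOT IN PRINT; OUR BOOKKEEPING ([folklore]).  **RIGHT TRANSPOSED CORRECTOR, RIGHT LEG WEIGHTED**: for `X` with summable rows at `(x, a)`,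
`Σ'_z ω z · (X ∘ Ψ̂_Sᵀ)(x, z)_{ab} = Σ'_z ω z · X(x, z)_{ab}` (`SymCorrectorKernel.comp_trK_psiKS_inl` + `tsum_weight_mul_corrPsiS`). -/
theorem tsum_weight_mul_comp_trK_psiKS_right (X : MKer (d + 1) (Fib d)) (x : Site (d + 1)) (a b : Fib d) (hX : ∀ b' : Fib d, Summable fun z => X x z a b')
    {ω : Site (d + 1) → ℝ} {B : ℝ} (hω : ∀ z, |ω z| ≤ B) (hωper : ∀ z t : Site (d + 1), ω (z + (n : ℤ) • t) = ω z) :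
    ∑' z, ω z * comp X (trK (psiKS r n)) x z a b = ∑' z, ω z * X x z a b := by
  rcases b with β | m
  · rw [tsum_congr fun z => by rw [comp_trK_psiKS_inl hn hr X x z a β]]
    exact tsum_weight_mul_corrPsiS hn hr (F := fun κ y => X x y a (Sum.inl κ)) (fun κ => hX (Sum.inl κ)) hω hωper β
  · exact tsum_congr fun z => by rw [comp_trK_psiKS_inr X x z a m]

omit hn hr in
/-- [folklore] A summable family times a bounded weight (weight on the right) is summable. -/
theorem summable_weight_mul' {ω g : Site (d + 1) → ℝ} {B : ℝ} (hω : ∀ x, |ω x| ≤ B) (hg : Summable g) : Summable fun x => g x * ω x := by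
  simpa only [mul_comm] using summable_weight_mul hω hg

/-! ## §3b The inner pair: the multiplier rows of the conjugated middle kernel against a periodic current -/

/-- NOT IN PRINT; OUR BOOKKEEPING ([folklore]).  **THE `hkill`-TRANSFER OF (24)_comb**: for a decaying kernel `X` (rate `δ > 0`) and a current `t` whose components `t b ·` are
`n`-periodic and bounded, the multiplier rows of the CONJUGATED kernel `Ψ̂_S ∘ X ∘ Ψ̂_Sᵀ` pair with `t` exactly as those of `X`:
`Σ'_z Σ_b (Ψ̂ X Ψ̂ᵀ)(y₁,z)_{inr m, inl b}·t b z = Σ'_z Σ_b X(y₁,z)_{inr m, inl b}·t b z` (left `Ψ̂` is the identity on multiplier rows, `SymCorrectorKernel.comp_psiKS_inr`; the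
right `Ψ̂ᵀ` drops by §3).  Hence (d1) «the multiplier rows of the dressed step kill the exit-face current» holds for the middle kernel `Ψ̂ X̃ Ψ̂ᵀ` of the transport-stripped comb word. -/
theorem tsum_sum_conj_psiKS_inr_inl_mul_periodic {X : MKer (d + 1) (Fib d)} {C δ : ℝ} (hX : Decays X C δ) (hδ : 0 < δ)
    {t : Fin (d + 1) → Site (d + 1) → ℝ} {B : ℝ} (ht : ∀ b z, |t b z| ≤ B) (htper : ∀ (b : Fin (d + 1)) (z s : Site (d + 1)), t b (z + (n : ℤ) • s) = t b z)
    (y₁ : Site (d + 1)) (m : Fin (d + 1)) :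
    ∑' z : Site (d + 1), ∑ b : Fin (d + 1), comp (comp (psiKS r n) X) (trK (psiKS r n)) y₁ z (Sum.inr m) (Sum.inl b) * t b z
      = ∑' z : Site (d + 1), ∑ b : Fin (d + 1), X y₁ z (Sum.inr m) (Sum.inl b) * t b z := by
  -- the left `Ψ̂` is the identity on a multiplier row
  have e : ∀ (z : Site (d + 1)) (b : Fin (d + 1)), comp (comp (psiKS r n) X) (trK (psiKS r n)) y₁ z (Sum.inr m) (Sum.inl b)
      = comp X (trK (psiKS r n)) y₁ z (Sum.inr m) (Sum.inl b) := fun z b => by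
    rw [comp_trK_psiKS_inl hn hr (comp (psiKS r n) X) y₁ z (Sum.inr m) b, comp_trK_psiKS_inl hn hr X y₁ z (Sum.inr m) b]
    simp only [comp_psiKS_inr]
  simp only [e]
  -- rows of `X ∘ Ψ̂ᵀ` and of `X` are summable
  have hXT : Decays (comp X (trK (psiKS r n))) _ (δ / 2) :=
    decays_comp hX (decays_trK (decays_psiKS hn hr hδ.le)) (show (0 : ℝ) ≤ δ / 2 by positivity) (by linarith)
  have hs1 : ∀ b : Fin (d + 1), Summable fun z => comp X (trK (psiKS r n)) y₁ z (Sum.inr m) (Sum.inl b) * t b z := fun b =>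
    summable_weight_mul' (ht b) (summable_row_of_decays hXT (by positivity) y₁ (Sum.inr m) (Sum.inl b))
  have hs2 : ∀ b : Fin (d + 1), Summable fun z => X y₁ z (Sum.inr m) (Sum.inl b) * t b z := fun b =>
    summable_weight_mul' (ht b) (summable_row_of_decays hX hδ y₁ (Sum.inr m) (Sum.inl b))
  rw [Summable.tsum_finsetSum (fun b _ => hs1 b), Summable.tsum_finsetSum (fun b _ => hs2 b)]
  refine Finset.sum_congr rfl fun b _ => ?_
  have c1 : ∀ (K : MKer (d + 1) (Fib d)) (z : Site (d + 1)), K y₁ z (Sum.inr m) (Sum.inl b) * t b z = t b z * K y₁ z (Sum.inr m) (Sum.inl b) := fun K z => mul_comm _ _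
  simp only [c1]
  exact tsum_weight_mul_comp_trK_psiKS_right hn hr X y₁ (Sum.inr m) (Sum.inl b) (fun b' => summable_row_of_decays hX hδ y₁ (Sum.inr m) b') (ht b) (htper b)

/-! ## §3c Both outer legs of a conjugate at once: the face-weighted double leg sum -/

/-- [folklore] **A CONJUGATE `Ψ̂_Sᵀ ∘ Z ∘ Ψ̂_S` OF A BI-LOCALISED KERNEL IS BI-LOCALISED** at the same points (rate `δ∕4`; `Ψ̂_S` decays at every rate, `SymCorrectorKernel.decays_psiKS`). -/
theorem exists_biLoc_conj_psiKS {Z : MKer (d + 1) (Fib d)} {p q : Site (d + 1)} {C δ : ℝ} (hZ : BiLoc Z p q C δ) (hδ : 0 < δ) :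
    ∃ C' : ℝ, BiLoc (comp (comp (trK (psiKS r n)) Z) (psiKS r n)) p q C' (δ / 4) := by
  have h1 := biLoc_comp_decays (decays_trK (decays_psiKS hn hr hδ.le)) hZ (show (0 : ℝ) ≤ δ / 2 by positivity) (by linarith)
  exact ⟨_, biLoc_comp_right h1 (decays_psiKS hn hr (show (0 : ℝ) ≤ δ / 2 by positivity)) (show (0 : ℝ) ≤ δ / 4 by positivity) (by linarith)⟩

/-- [folklore] The left-transported kernel `Ψ̂_Sᵀ ∘ Z` of a bi-localised `Z` is bi-localised (rate `δ∕2`). -/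
theorem exists_biLoc_trK_psiKS_comp {Z : MKer (d + 1) (Fib d)} {p q : Site (d + 1)} {C δ : ℝ} (hZ : BiLoc Z p q C δ) (hδ : 0 < δ) :
    ∃ C' : ℝ, BiLoc (comp (trK (psiKS r n)) Z) p q C' (δ / 2) :=
  ⟨_, biLoc_comp_decays (decays_trK (decays_psiKS hn hr hδ.le)) hZ (show (0 : ℝ) ≤ δ / 2 by positivity) (by linarith)⟩

omit hn hr in
/-- [folklore] A doubly weighted bi-localised kernel (bounded weights) is summable over both legs. -/
theorem summable_prod_weight₂_of_biLoc {K : MKer (d + 1) (Fib d)} {p q : Site (d + 1)} {C δ : ℝ} (hK : BiLoc K p q C δ) (hδ : 0 < δ)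
    {ω₁ ω₂ : Site (d + 1) → ℝ} {B₁ B₂ : ℝ} (h₁ : ∀ y, |ω₁ y| ≤ B₁) (h₂ : ∀ w, |ω₂ w| ≤ B₂) (a b : Fib d) :
    Summable fun yw : Site (d + 1) × Site (d + 1) => ω₁ yw.1 * ω₂ yw.2 * K yw.1 yw.2 a b := by
  refine Summable.of_norm_bounded (((summable_prod_of_biLoc hK hδ a b).abs).mul_left (B₁ * B₂)) fun yw => ?_
  rw [Real.norm_eq_abs, abs_mul, abs_mul]
  have hB₁ : 0 ≤ B₁ := (abs_nonneg _).trans (h₁ yw.1)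
  exact mul_le_mul (mul_le_mul (h₁ yw.1) (h₂ yw.2) (abs_nonneg _) hB₁) le_rfl (abs_nonneg _) (mul_nonneg hB₁ ((abs_nonneg _).trans (h₂ yw.2)))

omit hn hr in
/-- [folklore] Swapping the two legs of a summable doubly-indexed family under `Σ'` over the product. -/
theorem tsum_prod_swap (F : Site (d + 1) → Site (d + 1) → ℝ) :
    ∑' yw : Site (d + 1) × Site (d + 1), F yw.1 yw.2 = ∑' wy : Site (d + 1) × Site (d + 1), F wy.2 wy.1 := by
  rw [← (Equiv.prodComm (Site (d + 1)) (Site (d + 1))).tsum_eq (fun wy : Site (d + 1) × Site (d + 1) => F wy.2 wy.1)]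
  rfl

/-- NOT IN PRINT; OUR BOOKKEEPING ([folklore]).  **BOTH OUTER LEGS OF A TRANSPORTED KERNEL DROP UNDER PERIODIC BOUNDED LEG WEIGHTS**: for `Z` bi-localised (rate `δ > 0`) and
`n`-periodic bounded weights `ω₁`, `ω₂`, `Σ'_{(y,w)} ω₁ y·ω₂ w·(Ψ̂_Sᵀ ∘ Z ∘ Ψ̂_S)(y,w)_{ab} = Σ'_{(y,w)} ω₁ y·ω₂ w·Z(y,w)_{ab}` (§2 on each leg, with the leg order swapped
through the product sum in between).  With `ω₁ = 𝟙f(y_α)`, `ω₂ = 𝟙f(w_β)` this removes the OUTER transports of a two-face word of the comb forcing. -/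
theorem tsum_prod_weight_conj_psiKS {Z : MKer (d + 1) (Fib d)} {p q : Site (d + 1)} {C δ : ℝ} (hZ : BiLoc Z p q C δ) (hδ : 0 < δ)
    {ω₁ ω₂ : Site (d + 1) → ℝ} {B₁ B₂ : ℝ} (h₁ : ∀ y, |ω₁ y| ≤ B₁) (h₁per : ∀ y t : Site (d + 1), ω₁ (y + (n : ℤ) • t) = ω₁ y)
    (h₂ : ∀ w, |ω₂ w| ≤ B₂) (h₂per : ∀ w t : Site (d + 1), ω₂ (w + (n : ℤ) • t) = ω₂ w) (a b : Fib d) :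
    ∑' yw : Site (d + 1) × Site (d + 1), ω₁ yw.1 * ω₂ yw.2 * comp (comp (trK (psiKS r n)) Z) (psiKS r n) yw.1 yw.2 a b
      = ∑' yw : Site (d + 1) × Site (d + 1), ω₁ yw.1 * ω₂ yw.2 * Z yw.1 yw.2 a b := by
  obtain ⟨C₂, hZ₂⟩ := exists_biLoc_conj_psiKS hn hr hZ hδ
  obtain ⟨C₁, hZ₁⟩ := exists_biLoc_trK_psiKS_comp hn hr hZ hδ
  have hδ₂ : 0 < δ / 4 := by positivity
  have hδ₁ : 0 < δ / 2 := by positivity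
  set M := comp (trK (psiKS r n)) Z with hM
  -- step 1: the right leg, row by row
  have step1 : ∑' yw : Site (d + 1) × Site (d + 1), ω₁ yw.1 * ω₂ yw.2 * comp M (psiKS r n) yw.1 yw.2 a b
      = ∑' yw : Site (d + 1) × Site (d + 1), ω₁ yw.1 * ω₂ yw.2 * M yw.1 yw.2 a b := by
    rw [(summable_prod_weight₂_of_biLoc hZ₂ hδ₂ h₁ h₂ a b).tsum_prod, (summable_prod_weight₂_of_biLoc hZ₁ hδ₁ h₁ h₂ a b).tsum_prod]
    refine tsum_congr fun y => ?_
    simp only [mul_assoc]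
    rw [tsum_mul_left, tsum_mul_left, tsum_weight_mul_comp_psiKS_right hn hr M y a b (fun b' => summable_row_of_biLoc hZ₁ hδ₁ y a b') h₂ h₂per]
  -- step 2: the left leg, column by column, after swapping the legs
  have step2 : ∑' wy : Site (d + 1) × Site (d + 1), ω₁ wy.2 * ω₂ wy.1 * M wy.2 wy.1 a b
      = ∑' wy : Site (d + 1) × Site (d + 1), ω₁ wy.2 * ω₂ wy.1 * Z wy.2 wy.1 a b := by
    have hsM : Summable fun wy : Site (d + 1) × Site (d + 1) => ω₁ wy.2 * ω₂ wy.1 * M wy.2 wy.1 a b :=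
      ((summable_prod_weight₂_of_biLoc hZ₁ hδ₁ h₁ h₂ a b).comp_injective (Equiv.prodComm (Site (d + 1)) (Site (d + 1))).injective).congr
        fun wy => rfl
    have hsZ : Summable fun wy : Site (d + 1) × Site (d + 1) => ω₁ wy.2 * ω₂ wy.1 * Z wy.2 wy.1 a b :=
      ((summable_prod_weight₂_of_biLoc hZ hδ h₁ h₂ a b).comp_injective (Equiv.prodComm (Site (d + 1)) (Site (d + 1))).injective).congr
        fun wy => rfl
    rw [hsM.tsum_prod, hsZ.tsum_prod]
    refine tsum_congr fun w => ?_
    have e : ∀ (K : MKer (d + 1) (Fib d)) (y : Site (d + 1)), ω₁ y * ω₂ w * K y w a b = ω₂ w * (ω₁ y * K y w a b) := fun K y => by ring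
    simp only [e]
    rw [tsum_mul_left, tsum_mul_left, hM, tsum_weight_mul_comp_trK_psiKS_left hn hr Z w a b (fun a' => summable_col_of_biLoc hZ hδ w a' b) h₁ h₁per]
  rw [step1, tsum_prod_swap (fun y w => ω₁ y * ω₂ w * M y w a b), step2, ← tsum_prod_swap (fun y w => ω₁ y * ω₂ w * Z y w a b)]

end Transport

/-! ## §4 The bond sum of the dressed chain-rule vertex does not see the slot transport of its table -/

section DressedStep

variable {Lc : ℕ} [NeZero Lc] {rb : Fin (d + 1) → ℕ}

/-- NOT IN PRINT; OUR BOOKKEEPING ([folklore]).  **THE BOND SUM OF THE DRESSED CHAIN-RULE VERTEX IS BLIND TO THE SLOT TRANSPORT OF ITS TABLE** (in-block root `toSite rb`, `1 ≤ Lc`,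
every `j`, all units, any slot-transport root `r′`, every local stencil family `S`, every entry): `Σ'_{u′} vertexOfK X̃♮_j Lc (slotPsiS r′ Lc S) ν u′ p q c e
= Σ'_{u′} vertexOfK X̃♮_j Lc S ν u′ p q c e` — leaf-04's `DressedHalfVertex.hasSum_vertexOfK_dressedStep` turns either bond sum into the EXIT-FACE-WEIGHTED table sum
`(Lc s_m s_f)·cH_j·Σ'_t [t_ν % Lc = Lc−1]·T ν t p q c e`, the exit-face indicator is an `Lc`-periodic bounded slot weight, and leaf-01 g85 F7
(`SlotTransportPeriodicWeight.tsum_weight_mul_slotPsiS_kernel`) removes the slot transport under such a weight.  This is the resummed-slot step of (24)_comb. -/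
theorem tsum_vertexOfK_dressedStep_slotPsiS (hLc : 1 ≤ Lc) (hrb : rb ∈ box (d + 1) Lc) (sf sm : ℝ) (j : ℕ) (ν : Fin (d + 1)) (r' : Fin (d + 1) → ℕ)
    {S : Fin (d + 1) → Site (d + 1) → MKer (d + 1) (Fib d)} {Cs δs : ℝ} (hS : LocStencil S Cs δs) (hδs : 0 < δs) (p q : Site (d + 1)) (c e : Fib d) :
    ∑' u' : Site (d + 1), vertexOfK (unitK sf sm (coDressKBmAt (toSite rb) Lc (KInvStep (d := d) Lc j))) Lc (slotPsiS r' Lc S) ν u' p q c e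
      = ∑' u' : Site (d + 1), vertexOfK (unitK sf sm (coDressKBmAt (toSite rb) Lc (KInvStep (d := d) Lc j))) Lc S ν u' p q c e := by
  classical
  have hLc0 : 0 < Lc := hLc
  rw [(hasSum_vertexOfK_dressedStep hLc hrb sf sm j ν (locStencil_slotPsiS (d := d) hLc0 r' hS hδs.le) hδs p q c e).tsum_eq,
    (hasSum_vertexOfK_dressedStep hLc hrb sf sm j ν hS hδs p q c e).tsum_eq]
  congr 1
  have e1 : ∀ (T : Fin (d + 1) → Site (d + 1) → MKer (d + 1) (Fib d)) (t : Site (d + 1)),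
      (if t ν % (Lc : ℤ) = (Lc : ℤ) - 1 then T ν t p q c e else 0) = (if t ν % (Lc : ℤ) = (Lc : ℤ) - 1 then (1 : ℝ) else 0) * T ν t p q c e := fun T t => by
    split_ifs <;> simp
  simp only [e1]
  refine tsum_weight_mul_slotPsiS_kernel hLc0 r' p q c e (fun κ => summable_slice_of_locStencil hS hδs κ p q c e) (B := 1)
    (fun t => by split_ifs <;> simp) (fun t s => ?_) ν
  have hper : (t + (Lc : ℤ) • s) ν % (Lc : ℤ) = t ν % (Lc : ℤ) := by
    simp only [Pi.add_apply, Pi.smul_apply, smul_eq_mul, Int.add_mul_emod_self_left]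
  simp only [hper]

end DressedStep

end Summit.QuantumFields.BalabanUV.Beta.GAN24.CombSlotResumTransport

end
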